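import Summits.AtomisticToContinuum.BoseEinsteinCondensation.Theorems.BECStronglyRayleighLatticeToPeriodicBridgeRowFlatnessSandwich
import Literature.MathematicalPhysics.QuantumManyBody.PeriodicBoseGasRelabelling
import Literature.MathematicalPhysics.QuantumManyBody.MeanSelfDensity

/-!
# Route `BECStronglyRayleigh`, crux `LatticeToPeriodicBridge` (stmt-AtomisticToContinuum-9674),
# line `coarse-cell-lorentzian` — slot means and the many-slot Cauchy–Schwarz inequality (`⟨n̂₀²⟩ ≥ ⟨n̂₀⟩²`)

Helper file of the crux line `coarse-cell-lorentzian`, landed `--supports stmt-AtomisticToContinuum-9674` (first of two files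
closing the formal gap between the halves of the row-flatness SANDWICH; the second, `…PairFromSingle.lean`, applies it to real
non-negative periodic trial states). For a measurable, permutation-symmetric `F ≥ 0` on `cell^{n+2}` (think `F = |Ψ|`) with
`∫ F² ≤ 1`, the SLOT MEANS `Aᵢ(X) = ∫_{t∈cell} F(X[i := t]) dt` satisfy, by relabelling invariance of Lebesgue measure on the
cell (`setLIntegral_cellN_comp_perm`) and Tonelli along `vecCons`,
`∫ F·Aᵢ = S₁`, `∫ Aᵢ² = L³·S₁`, `∫ AᵢAⱼ = S₂ (i ≠ j)` with `S₁ = ∫_Y (∫_x F(x::Y))²` (`= L³·n₀/N`) and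
`S₂ = ∫_{X'} (∫_ξ∫_η F(ξ::η::X'))²` (`= L⁶·⟨P₀⊗P₀⊗1⟩`); Cauchy–Schwarz against `G = Σᵢ Aᵢ` (`= L³·n̂₀ Ψ / Ψ` in first
quantisation) then gives the **many-slot inequality** `many_slot_cauchySchwarz : (n+2)·S₁² ≤ L³·S₁ + (n+1)·S₂`, i.e.
`⟨n̂₀⟩² ≤ ⟨n̂₀²⟩ = ⟨n̂₀⟩ + N(N−1)⟨P₀⊗P₀⊗1⟩` for normalised `Ψ`.

References: C. N. Yang, Rev. Mod. Phys. 34 (1962) 694 (ODLRO, `⟨n̂₀²⟩`); O. Penrose, L. Onsager, Phys. Rev. 104 (1956) 576.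
-/

noncomputable section

open MeasureTheory Filter Metric Set Function
open scoped ENNReal Topology NNReal Real

namespace Summit.AtomisticToContinuum.BoseEinsteinCondensation.Cruxes.LatticeToPeriodicBridge.CoarseCellLorentzian

namespace PairFromSingle

open Literature.MathematicalPhysics.QuantumManyBody.BoseGas
/-! ## Slot means `Aᵢ(X) = ∫_{t ∈ cell} F(X[i := t])` of a measurable symmetric `F ≥ 0` -/

section Slots

variable {n : ℕ} {L : ℝ} {F : Config (n + 1) → ℝ≥0∞}

/-- `(X, t) ↦ F(X[i := t])` is measurable. [folklore] -/
theorem measurable_update_uncurry (hF : Measurable F) (i : Fin (n + 1)) :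
    Measurable fun p : Config (n + 1) × Space => F (update p.1 i p.2) :=
  hF.comp measurable_update'

/-- The slot mean `X ↦ ∫_{cell} F(X[i := t]) dt` is measurable. [folklore] -/
theorem measurable_slotMean (hF : Measurable F) (L : ℝ) (i : Fin (n + 1)) :
    Measurable fun X : Config (n + 1) => ∫⁻ t in cell L, F (update X i t) :=
  (measurable_update_uncurry hF i).lintegral_prod_right'

/-- **Relabelling a slot mean**: for a permutation-symmetric `F`,
`∫ F((X ∘ σ)[i := t]) dt = ∫ F(X[σ i := t]) dt`. [folklore] -/
theorem slotMean_comp_perm (hsymm : ∀ (σ : Equiv.Perm (Fin (n + 1))) (X : Config (n + 1)), F (X ∘ σ) = F X)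
    (σ : Equiv.Perm (Fin (n + 1))) (i : Fin (n + 1)) (X : Config (n + 1)) :
    ∫⁻ t in cell L, F (update (X ∘ σ) i t) = ∫⁻ t in cell L, F (update X (σ i) t) := by
  refine lintegral_congr fun t => ?_
  have h : update (X ∘ σ) i t = update X (σ i) t ∘ σ := by
    rw [update_comp_equiv X σ (σ i) t, Equiv.symm_apply_apply]
  rw [h, hsymm]

/-- **`∫ F·Aᵢ` does not depend on the slot**: `∫_{cellN} F(X) Aᵢ(X) = ∫_{cellN} F(X) A₀(X)`. [folklore] -/
theorem setLIntegral_mul_slotMean_eq_zero (hsymm : ∀ (σ : Equiv.Perm (Fin (n + 1))) (X : Config (n + 1)), F (X ∘ σ) = F X)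
    (i : Fin (n + 1)) :
    ∫⁻ X in cellN (n + 1) L, F X * ∫⁻ t in cell L, F (update X i t) =
      ∫⁻ X in cellN (n + 1) L, F X * ∫⁻ t in cell L, F (update X 0 t) := by
  set σ : Equiv.Perm (Fin (n + 1)) := Equiv.swap 0 i with hσ
  have hσi : σ i = 0 := by rw [hσ, Equiv.swap_apply_right]
  rw [← setLIntegral_cellN_comp_perm σ (fun X => F X * ∫⁻ t in cell L, F (update X i t))]
  refine lintegral_congr fun X => ?_
  rw [hsymm, slotMean_comp_perm hsymm σ i X, hσi]

/-- **`∫ Aᵢ²` does not depend on the slot.** [folklore] -/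
theorem setLIntegral_slotMean_sq_eq_zero (hsymm : ∀ (σ : Equiv.Perm (Fin (n + 1))) (X : Config (n + 1)), F (X ∘ σ) = F X)
    (i : Fin (n + 1)) :
    ∫⁻ X in cellN (n + 1) L, (∫⁻ t in cell L, F (update X i t)) ^ 2 =
      ∫⁻ X in cellN (n + 1) L, (∫⁻ t in cell L, F (update X 0 t)) ^ 2 := by
  set σ : Equiv.Perm (Fin (n + 1)) := Equiv.swap 0 i with hσ
  have hσi : σ i = 0 := by rw [hσ, Equiv.swap_apply_right]
  rw [← setLIntegral_cellN_comp_perm σ (fun X => (∫⁻ t in cell L, F (update X i t)) ^ 2)]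
  refine lintegral_congr fun X => ?_
  rw [slotMean_comp_perm hsymm σ i X, hσi]

/-- **`∫ Aᵢ Aⱼ` (`i ≠ j`) does not depend on the pair of slots**: it equals `∫ A₀ A₁` (needs `n + 1 ≥ 2`). [folklore] -/
theorem setLIntegral_slotMean_mul_eq_zero_one {n : ℕ} {F : Config (n + 2) → ℝ≥0∞}
    (hsymm : ∀ (σ : Equiv.Perm (Fin (n + 2))) (X : Config (n + 2)), F (X ∘ σ) = F X)
    {i j : Fin (n + 2)} (hij : i ≠ j) :
    ∫⁻ X in cellN (n + 2) L, (∫⁻ t in cell L, F (update X i t)) * ∫⁻ t in cell L, F (update X j t) =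
      ∫⁻ X in cellN (n + 2) L, (∫⁻ t in cell L, F (update X 0 t)) * ∫⁻ t in cell L, F (update X 1 t) := by
  -- a permutation with `π i = 0`, `π j = 1`
  set σ₁ : Equiv.Perm (Fin (n + 2)) := Equiv.swap 0 i with hσ₁
  set j' : Fin (n + 2) := σ₁ j with hj'
  have hσ₁i : σ₁ i = 0 := by rw [hσ₁, Equiv.swap_apply_right]
  have hj'0 : j' ≠ 0 := by
    intro h
    apply hij
    have : σ₁ j = σ₁ i := by rw [hσ₁i]; exact h
    exact (σ₁.injective this).symm
  set σ₂ : Equiv.Perm (Fin (n + 2)) := Equiv.swap 1 j' with hσ₂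
  have hσ₂j' : σ₂ j' = 1 := by rw [hσ₂, Equiv.swap_apply_right]
  have hσ₂0 : σ₂ 0 = 0 := by
    rw [hσ₂, Equiv.swap_apply_of_ne_of_ne Fin.zero_ne_one hj'0.symm]
  set τ : Equiv.Perm (Fin (n + 2)) := σ₁.trans σ₂ with hτ
  have hτi : τ i = 0 := by rw [hτ, Equiv.trans_apply, hσ₁i, hσ₂0]
  have hτj : τ j = 1 := by rw [hτ, Equiv.trans_apply, ← hj', hσ₂j']
  rw [← setLIntegral_cellN_comp_perm τ
    (fun X => (∫⁻ t in cell L, F (update X i t)) * ∫⁻ t in cell L, F (update X j t))]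
  refine lintegral_congr fun X => ?_
  rw [slotMean_comp_perm hsymm τ i X, slotMean_comp_perm hsymm τ j X, hτi, hτj]

end Slots

/-! ## The slot-`0` and slot-`(0,1)` integrals through `vecCons` -/

section Cons

variable {n : ℕ} {L : ℝ}

/-- `X[0 := t] = t :: tail X` on `vecCons x Y`. [folklore] -/
theorem update_vecCons_zero (x t : Space) (Y : Config n) :
    update (Matrix.vecCons x Y : Config (n + 1)) 0 t = Matrix.vecCons t Y :=
  Fin.update_cons_zero (α := fun _ : Fin (n + 1) => Space) x Y t

/-- `(ξ :: η :: X')[1 := s] = ξ :: s :: X'`. [folklore] -/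
theorem update_vecCons_one (ξ η s : Space) (X' : Config n) :
    update (Matrix.vecCons ξ (Matrix.vecCons η X') : Config (n + 2)) 1 s =
      Matrix.vecCons ξ (Matrix.vecCons s X') := by
  have h := Fin.cons_update (α := fun _ : Fin (n + 2) => Space) ξ (Matrix.vecCons η X' : Config (n + 1)) 0 s
  rw [update_vecCons_zero η s X', Fin.succ_zero_eq_one] at h
  exact h.symm

variable {F : Config (n + 1) → ℝ≥0∞}

/-- Measurability of a `vecCons` slice `x ↦ F(x :: Y)`. [folklore] -/
theorem measurable_vecCons_slice (hF : Measurable F) (Y : Config n) :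
    Measurable fun x : Space => F (Matrix.vecCons x Y) :=
  hF.comp (measurable_vecCons_left Y)

/-- **`∫ F·A₀ = S₁`**: `∫_{cellN} F(X) ∫_t F(X[0:=t]) = ∫_Y (∫_x F(x::Y))²`. [folklore] -/
theorem setLIntegral_mul_slotMean_zero (hF : Measurable F) :
    ∫⁻ X in cellN (n + 1) L, F X * ∫⁻ t in cell L, F (update X 0 t) =
      ∫⁻ Y in cellN n L, (∫⁻ x in cell L, F (Matrix.vecCons x Y)) ^ 2 := by
  have hm : Measurable fun X : Config (n + 1) => F X * ∫⁻ t in cell L, F (update X 0 t) :=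
    hF.mul (measurable_slotMean hF L 0)
  rw [setLIntegral_cellN_succ_right hm]
  refine lintegral_congr fun Y => ?_
  simp only [update_vecCons_zero]
  rw [lintegral_mul_const _ (measurable_vecCons_slice hF Y), sq]

/-- **`∫ A₀² = L³·S₁`**: `∫_{cellN} (∫_t F(X[0:=t]))² = |cell| · ∫_Y (∫_x F(x::Y))²`. [folklore] -/
theorem setLIntegral_slotMean_zero_sq (hF : Measurable F) :
    ∫⁻ X in cellN (n + 1) L, (∫⁻ t in cell L, F (update X 0 t)) ^ 2 =
      ENNReal.ofReal L ^ 3 * ∫⁻ Y in cellN n L, (∫⁻ x in cell L, F (Matrix.vecCons x Y)) ^ 2 := by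
  have hm : Measurable fun X : Config (n + 1) => (∫⁻ t in cell L, F (update X 0 t)) ^ 2 :=
    (measurable_slotMean hF L 0).pow_const 2
  rw [setLIntegral_cellN_succ_left hm]
  simp only [update_vecCons_zero]
  rw [setLIntegral_const, volume_cell, mul_comm]

end Cons

section ConsTwo

variable {n : ℕ} {L : ℝ} {F : Config (n + 2) → ℝ≥0∞}

/-- Joint measurability of `(ξ, η) ↦ F(ξ :: η :: X')`. [folklore] -/
theorem measurable_vecCons_vecCons (hF : Measurable F) (X' : Config n) :
    Measurable fun p : Space × Space => F (Matrix.vecCons p.1 (Matrix.vecCons p.2 X')) :=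
  hF.comp (CellNormRetention.continuous_finCons_finCons_left X').measurable

/-- **Tonelli swap for the tagged pair**: `∫_η ∫_ξ F(ξ::η::X') = ∫_ξ ∫_η F(ξ::η::X')`. [folklore] -/
theorem lintegral_lintegral_vecCons_swap (hF : Measurable F) (X' : Config n) :
    ∫⁻ η in cell L, ∫⁻ ξ in cell L, F (Matrix.vecCons ξ (Matrix.vecCons η X')) =
      ∫⁻ ξ in cell L, ∫⁻ η in cell L, F (Matrix.vecCons ξ (Matrix.vecCons η X')) := by
  have hf := measurable_vecCons_vecCons hF X'
  have hswap : Measurable fun p : Space × Space => F (Matrix.vecCons p.2 (Matrix.vecCons p.1 X')) :=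
    hf.comp measurable_swap
  exact lintegral_lintegral_swap (μ := volume.restrict (cell L)) (ν := volume.restrict (cell L))
    (f := fun η ξ => F (Matrix.vecCons ξ (Matrix.vecCons η X'))) hswap.aemeasurable

/-- **`∫ A₀ A₁ = S₂`**: `∫_{cellN} (∫_t F(X[0:=t]))(∫_s F(X[1:=s])) = ∫_{X'} (∫_ξ∫_η F(ξ::η::X'))²`. [folklore] -/
theorem setLIntegral_slotMean_zero_mul_one (hF : Measurable F) :
    ∫⁻ X in cellN (n + 2) L, (∫⁻ t in cell L, F (update X 0 t)) * ∫⁻ s in cell L, F (update X 1 s) =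
      ∫⁻ X' in cellN n L, (∫⁻ ξ in cell L, ∫⁻ η in cell L, F (Matrix.vecCons ξ (Matrix.vecCons η X'))) ^ 2 := by
  set H : Config (n + 2) → ℝ≥0∞ := fun X =>
    (∫⁻ t in cell L, F (update X 0 t)) * ∫⁻ s in cell L, F (update X 1 s) with hH
  have hm : Measurable H := (measurable_slotMean hF L 0).mul (measurable_slotMean hF L 1)
  -- peel the first coordinate (bath of `n+1` outermost), then the second
  rw [setLIntegral_cellN_succ_right hm]
  have hK : Measurable fun Z : Config (n + 1) => ∫⁻ ξ in cell L, H (Matrix.vecCons ξ Z) :=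
    (hm.comp measurable_vecCons_prod).lintegral_prod_left'
  rw [setLIntegral_cellN_succ_right hK]
  refine lintegral_congr fun X' => ?_
  -- the integrand at `(ξ, η, X')`
  have hf := measurable_vecCons_vecCons hF X'
  have hC : Measurable fun η : Space => ∫⁻ t in cell L, F (Matrix.vecCons t (Matrix.vecCons η X')) :=
    hf.lintegral_prod_left'
  have hD : Measurable fun ξ : Space => ∫⁻ s in cell L, F (Matrix.vecCons ξ (Matrix.vecCons s X')) :=
    hf.lintegral_prod_right'
  have hpt : ∀ ξ η : Space, H (Matrix.vecCons ξ (Matrix.vecCons η X')) =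
      (∫⁻ t in cell L, F (Matrix.vecCons t (Matrix.vecCons η X'))) *
        ∫⁻ s in cell L, F (Matrix.vecCons ξ (Matrix.vecCons s X')) := fun ξ η => by
    simp only [hH, update_vecCons_zero, update_vecCons_one]
  simp_rw [hpt]
  -- `∫_η ∫_ξ C(η) D(ξ) = (∫_η C)(∫_ξ D)`
  have hin : ∀ η : Space,
      ∫⁻ ξ in cell L, (∫⁻ t in cell L, F (Matrix.vecCons t (Matrix.vecCons η X'))) *
          ∫⁻ s in cell L, F (Matrix.vecCons ξ (Matrix.vecCons s X')) =
        (∫⁻ t in cell L, F (Matrix.vecCons t (Matrix.vecCons η X'))) *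
          ∫⁻ ξ in cell L, ∫⁻ s in cell L, F (Matrix.vecCons ξ (Matrix.vecCons s X')) := fun η =>
    lintegral_const_mul _ hD
  simp_rw [hin]
  rw [lintegral_mul_const _ hC, lintegral_lintegral_vecCons_swap hF X', sq]

end ConsTwo

/-! ## The many-slot Cauchy–Schwarz inequality -/

section ManySlot

variable {n : ℕ} {L : ℝ} {F : Config (n + 2) → ℝ≥0∞}

/-- **Many-slot Cauchy–Schwarz** (`⟨Ψ,n̂₀Ψ⟩² ≤ ‖Ψ‖²‖n̂₀Ψ‖²` in integrals): for a measurable, permutation-symmetric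
`F ≥ 0` on `cell^{n+2}` with `∫ F² ≤ 1`,
`(n+2)·S₁² ≤ L³·S₁ + (n+1)·S₂` with `S₁ = ∫_Y (∫_x F(x::Y))²`, `S₂ = ∫_{X'} (∫_ξ∫_η F(ξ::η::X'))²`. [folklore] -/
theorem many_slot_cauchySchwarz (hF : Measurable F)
    (hsymm : ∀ (σ : Equiv.Perm (Fin (n + 2))) (X : Config (n + 2)), F (X ∘ σ) = F X)
    (hnorm : ∫⁻ X in cellN (n + 2) L, F X ^ 2 ≤ 1) :
    ((n : ℝ≥0∞) + 2) * (∫⁻ Y in cellN (n + 1) L, (∫⁻ x in cell L, F (Matrix.vecCons x Y)) ^ 2) ^ 2 ≤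
      ENNReal.ofReal L ^ 3 * (∫⁻ Y in cellN (n + 1) L, (∫⁻ x in cell L, F (Matrix.vecCons x Y)) ^ 2) +
        ((n : ℝ≥0∞) + 1) *
          ∫⁻ X' in cellN n L, (∫⁻ ξ in cell L, ∫⁻ η in cell L, F (Matrix.vecCons ξ (Matrix.vecCons η X'))) ^ 2 := by
  -- notation
  set S1 : ℝ≥0∞ := ∫⁻ Y in cellN (n + 1) L, (∫⁻ x in cell L, F (Matrix.vecCons x Y)) ^ 2 with hS1
  set S2 : ℝ≥0∞ := ∫⁻ X' in cellN n L,
    (∫⁻ ξ in cell L, ∫⁻ η in cell L, F (Matrix.vecCons ξ (Matrix.vecCons η X'))) ^ 2 with hS2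
  set A : Fin (n + 2) → Config (n + 2) → ℝ≥0∞ := fun i X => ∫⁻ t in cell L, F (update X i t) with hA
  set G : Config (n + 2) → ℝ≥0∞ := fun X => ∑ i, A i X with hG
  have hAm : ∀ i, Measurable (A i) := fun i => measurable_slotMean hF L i
  have hGm : Measurable G := Finset.measurable_sum _ fun i _ => hAm i
  set μ : Measure (Config (n + 2)) := volume.restrict (cellN (n + 2) L) with hμ
  set N2 : ℝ≥0∞ := (n : ℝ≥0∞) + 2 with hN2
  have hcard : (Finset.univ : Finset (Fin (n + 2))).card = n + 2 := by simp
  have hN2c : ((Fintype.card (Fin (n + 2)) : ℕ) : ℝ≥0∞) = N2 := by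
    rw [Fintype.card_fin]; push_cast; rfl
  -- (1) `∫ F G = (n+2) S1`
  have h1 : ∫⁻ X, F X * G X ∂μ = N2 * S1 := by
    have hsum : ∀ X, F X * G X = ∑ i, F X * A i X := fun X => by rw [hG]; exact Finset.mul_sum _ _ _
    simp_rw [hsum]
    rw [lintegral_finsetSum _ (f := fun i X => F X * A i X) fun i _ => hF.mul (hAm i)]
    have hi : ∀ i, ∫⁻ X, F X * A i X ∂μ = S1 := fun i => by
      rw [hμ, hA]
      simp only []
      rw [setLIntegral_mul_slotMean_eq_zero hsymm i, setLIntegral_mul_slotMean_zero hF]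
    simp_rw [hi]
    rw [Finset.sum_const, Finset.card_univ, nsmul_eq_mul, hN2c]
  -- (2) `∫ G² = (n+2)(L³ S1 + (n+1) S2)`
  have h2 : ∫⁻ X, G X ^ 2 ∂μ = N2 * (ENNReal.ofReal L ^ 3 * S1 + ((n : ℝ≥0∞) + 1) * S2) := by
    have hsq : ∀ X, G X ^ 2 = ∑ i, ∑ j, A i X * A j X := fun X => by
      rw [sq, hG]
      exact Finset.sum_mul_sum _ _ _ _
    simp_rw [hsq]
    rw [lintegral_finsetSum _ (f := fun i X => ∑ j, A i X * A j X)
      fun i _ => Finset.measurable_sum _ fun j _ => (hAm i).mul (hAm j)]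
    have hdiag : ∀ i, ∫⁻ X, A i X * A i X ∂μ = ENNReal.ofReal L ^ 3 * S1 := fun i => by
      rw [hμ, hA]
      simp only [← sq]
      rw [setLIntegral_slotMean_sq_eq_zero hsymm i, setLIntegral_slotMean_zero_sq hF]
    have hoff : ∀ i j, i ≠ j → ∫⁻ X, A i X * A j X ∂μ = S2 := fun i j hij => by
      rw [hμ, hA]
      simp only []
      rw [setLIntegral_slotMean_mul_eq_zero_one hsymm hij, setLIntegral_slotMean_zero_mul_one hF]
    have hrow : ∀ i, ∫⁻ X, ∑ j, A i X * A j X ∂μ = ENNReal.ofReal L ^ 3 * S1 + ((n : ℝ≥0∞) + 1) * S2 := by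
      intro i
      rw [lintegral_finsetSum _ (f := fun j X => A i X * A j X) fun j _ => (hAm i).mul (hAm j)]
      rw [← Finset.add_sum_erase _ _ (Finset.mem_univ i), hdiag i]
      congr 1
      have hcard' : ((Finset.univ.erase i).card : ℝ≥0∞) = (n : ℝ≥0∞) + 1 := by
        rw [Finset.card_erase_of_mem (Finset.mem_univ i), Finset.card_univ, Fintype.card_fin]
        push_cast
        simp
      rw [Finset.sum_congr rfl fun j hj => hoff i j (Finset.ne_of_mem_erase hj).symm, Finset.sum_const,
        nsmul_eq_mul, hcard']
    simp_rw [hrow]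
    rw [Finset.sum_const, Finset.card_univ, nsmul_eq_mul, hN2c]
  -- (3) Cauchy–Schwarz and `∫ F² ≤ 1`
  have hCS := lintegral_mul_sq_le μ hF.aemeasurable hGm.aemeasurable
  rw [h1, h2] at hCS
  have hF2 : ∫⁻ X, F X ^ 2 ∂μ ≤ 1 := hnorm
  have key : (N2 * S1) ^ 2 ≤ N2 * (ENNReal.ofReal L ^ 3 * S1 + ((n : ℝ≥0∞) + 1) * S2) := by
    refine hCS.trans ?_
    calc (∫⁻ X, F X ^ 2 ∂μ) * (N2 * (ENNReal.ofReal L ^ 3 * S1 + ((n : ℝ≥0∞) + 1) * S2))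
        ≤ 1 * (N2 * (ENNReal.ofReal L ^ 3 * S1 + ((n : ℝ≥0∞) + 1) * S2)) := by gcongr
      _ = _ := one_mul _
  -- cancel one factor `N2`
  have hN2ne : N2 ≠ 0 := by rw [hN2]; positivity
  have hN2top : N2 ≠ ⊤ := by rw [hN2]; exact ENNReal.add_ne_top.2 ⟨ENNReal.natCast_ne_top n, by simp⟩
  have key' : N2 * (N2 * S1 ^ 2) ≤ N2 * (ENNReal.ofReal L ^ 3 * S1 + ((n : ℝ≥0∞) + 1) * S2) := by
    calc N2 * (N2 * S1 ^ 2) = (N2 * S1) ^ 2 := by ring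
      _ ≤ _ := key
  exact (ENNReal.mul_le_mul_iff_right hN2ne hN2top).1 key'

end ManySlot

end PairFromSingle

/-- **Registered form of the many-slot Cauchy–Schwarz inequality** (sub-goal `pairSlotMeans_manySlotCauchySchwarz` of the crux item,
signature verbatim, fully qualified; = `PairFromSingle.many_slot_cauchySchwarz`). [folklore] -/
theorem pairSlotMeans_manySlotCauchySchwarz : ∀ (n : ℕ) (L : ℝ) (F : (Fin (n + 2) → EuclideanSpace ℝ (Fin 3)) → ENNReal), Measurable F → (∀ (σ : Equiv.Perm (Fin (n + 2))) (X : Fin (n + 2) → EuclideanSpace ℝ (Fin 3)), F (X ∘ σ) = F X) → MeasureTheory.lintegral (MeasureTheory.Measure.restrict MeasureTheory.volume (Literature.MathematicalPhysics.QuantumManyBody.BoseGas.cellN (n + 2) L)) (fun X => F X ^ 2) ≤ 1 → ((n : ENNReal) + 2) * (MeasureTheory.lintegral (MeasureTheory.Measure.restrict MeasureTheory.volume (Literature.MathematicalPhysics.QuantumManyBody.BoseGas.cellN (n + 1) L)) (fun Y => (MeasureTheory.lintegral (MeasureTheory.Measure.restrict MeasureTheory.volume (Literature.MathematicalPhysics.QuantumManyBody.BoseGas.cell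 L)) (fun x => F (Matrix.vecCons x Y))) ^ 2)) ^ 2 ≤ ENNReal.ofReal L ^ 3 * MeasureTheory.lintegral (MeasureTheory.Measure.restrict MeasureTheory.volume (Literature.MathematicalPhysics.QuantumManyBody.BoseGas.cellN (n + 1) L)) (fun Y => (MeasureTheory.lintegral (MeasureTheory.Measure.restrict MeasureTheory.volume (Literature.MathematicalPhysics.QuantumManyBody.BoseGas.cell L)) (fun x => F (Matrix.vecCons x Y))) ^ 2) + ((n : ENNReal) + 1) * MeasureTheory.lintegral (MeasureTheory.Measure.restrict MeasureTheory.volume (Literature.MathematicalPhysics.QuantumManyBody.BoseGas.cellN n L)) (fun X' => (MeasureTheory.lintegral (MeasureTheory.Measure.restrict MeasureTheory.volume (Literature.MathematicalPhysics.QuantumManyBody.BoseGas.cell L)) (fun ξ => MeasureTheory.lintegral (MeasureTheory.Measure.restrict MeasureTheory.volume (Literature.MathematicalPhysics.QuantumManyBody.BoseGas.cell L)) (fun η => F (Matrix.vecCons ξ (Matrix.vecCons η X'))))) ^ 2) :=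
  fun _ _ _ hF hsymm hnorm => PairFromSingle.many_slot_cauchySchwarz hF hsymm hnorm

end Summit.AtomisticToContinuum.BoseEinsteinCondensation.Cruxes.LatticeToPeriodicBridge.CoarseCellLorentzian

end
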